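import Literature.Probability.Percolation.TrapPairMenger
import HarnessLib

/-!
# The pair step with CLEAN routes: each route touches only the fence it ends at

Topic `Literature/Probability/Percolation`; family `crit-perc` / near-critical percolation on `𝕋`.
A brick of the near-critical arm-separation theorem for four arms in the ADJACENT colour
arrangement (P. Nolin, EJP 13 (2008), Thm. 11, `j = 4`, `σ = BBWW` [arXiv 0711.4948: Thm. 10];
the input `hsepAdj` of `Werner2009_lemma63_of_altSeparation_of_adjSeparation`).

`PairData.exists_two_disjoint_routes` (`TrapPairMenger.lean`) gives, for two arms of the same
colour in the setting `PairData` (Nolin 2008, §4.4, proof of Lemma 15, last paragraph), two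
vertex-disjoint admissible routes to the exterior fence sites `m_{u₀} ≠ m_{u₁}` of two distinct
terms; an admissible route may, however, wander through the connection `F_w` of the fence of a
third term, or of the term the OTHER route ends at. The landing step needs routes whose only
fence sites are those of their own fence. This file obtains them by running Menger's theorem in
the CONTRACTED graph `cG` in which every fence connection `F_u` is replaced by its end point `m_u`
(a non-fence site `x` is joined to `m_u` when `x` is `𝕋`-adjacent to a site of `F_u`), with the
admissible set `arms ∪ terms ∪ {m_u}`:

* `PairData.FF`, `Bset`, `AdjF`, `cG`, `cA` — all fence sites, the non-fence admissible sites
  (arms and terms), adjacency to a fence, the contracted graph, its admissible vertices;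
* `hcut_cG` — no admissible vertex of `cG` is a cut: a non-fence site `z` by `menger_hcut`
  (truncate an admissible `𝕋`-route avoiding `z` at its first fence site, `cRoute_of_route`), an
  end point `m_w` by the canonical fence-free route of the arm whose minimal term is not `w`
  (`canonical_route`, as in `not_isCut_of_not_mem_armSet`);
* `exists_two_clean_routes` — **two vertex-disjoint routes `S₀ ∋ a 0 ⇝ m_{u₀}`,
  `S₁ ∋ a 1 ⇝ m_{u₁}`, `u₀ ≠ u₁`, with `Sᵢ ⊆ (arms ∪ terms) ∪ F_{uᵢ}`** (Menger in `cG`, each path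
  truncated at its first end point and finished inside its own fence connection).

Everything here is proved; no named facts are introduced.

## References

* P. Nolin, Near-critical percolation in two dimensions, *Electron. J. Probab.* 13 (2008), §4.4,
  proof of Lemma 15 (arXiv 0711.4948: Lemma 14), last paragraph [Nolin2008].
* R. Diestel, *Graph Theory*, 5th ed. (2017), Thm. 3.3.1 (Menger) and §1.7 (contraction) [Diestel2017].

Tree: `exists_two_disjoint_paths` (`Combinatorics/SimpleGraph/MengerTwo.lean`), `PairData.menger_hcut`
(`TrapPairMenger.lean`), `PairData.αF_meet`, `uMin_spec`, `uMin_ne`, `fence_disjoint_arm/term/fence`,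
`term_eq` (`TrapPairSetting.lean`, `TrapPairRoutes.lean`), `PathIn.exit`, `PathIn.of_walk`,
`PathIn.exists_walk`.
-/

noncomputable section

open Set

namespace Literature.Probability.Percolation

open LatticeModels Literature.Combinatorics.SimpleGraph

namespace PairData

variable {M n k₀ K T : ℕ} {ω : SiteConfig (Site 2)}

/-! ### Fence sites, non-fence admissible sites, the contracted graph -/

/-- **All fence sites**: the union of the connections `F_u` of the fences of the terms. [folklore] -/
def FF (D : PairData M n k₀ K T ω) : Set (Site 2) :=
  {v | ∃ (u : ℕ) (c : Finset (Site 2)) (z : Site 2) (hu : (trapDomain M).lowestSeq ω u = some (c, z)), v ∈ (D.fence hu).F}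

/-- **The non-fence admissible sites**: the arms and the terms. [folklore] -/
def Bset (D : PairData M n k₀ K T ω) : Set (Site 2) :=
  D.armSet ∪ {v | ∃ (u : ℕ) (c : Finset (Site 2)) (z : Site 2) (_ : (trapDomain M).lowestSeq ω u = some (c, z)),
    v ∈ (↑c : Set (Site 2))}

/-- `Bset ⊆ Aset`. [folklore] -/
theorem Bset_subset_Aset (D : PairData M n k₀ K T ω) : D.Bset ⊆ D.Aset := by
  rintro v (hv | ⟨u, c, z, hu, hv⟩)
  · exact D.armSet_subset_Aset hv
  · exact D.term_subset_Aset hu hv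

/-- A non-fence admissible site lies in `Bset`. [folklore] -/
theorem mem_Bset_of_mem_Aset (D : PairData M n k₀ K T ω) {v : Site 2} (hv : v ∈ D.Aset) (hvF : v ∉ D.FF) : v ∈ D.Bset := by
  rcases hv with hv | ⟨u, c, z, hu, hv | hv⟩
  · exact Or.inl hv
  · exact Or.inr ⟨u, c, z, hu, hv⟩
  · exact absurd ⟨u, c, z, hu, hv⟩ hvF

/-- Arms and terms are not fence sites. [folklore] -/
theorem not_mem_FF_of_mem_Bset (D : PairData M n k₀ K T ω) {v : Site 2} (hv : v ∈ D.Bset) : v ∉ D.FF := by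
  rintro ⟨u, c, z, hu, hvF⟩
  rcases hv with hv | ⟨u', c', z', hu', hv⟩
  · exact D.fence_disjoint_arm hu hvF hv
  · exact D.fence_disjoint_term hu hu' hvF (Finset.mem_coe.1 hv)

/-- The targets are fence sites. [folklore] -/
theorem Tset_subset_FF (D : PairData M n k₀ K T ω) : D.Tset ⊆ D.FF := by
  rintro v ⟨u, c, z, hu, rfl⟩
  exact ⟨u, c, z, hu, (D.fence hu).m_mem⟩

/-- The starts are non-fence admissible sites. [folklore] -/
theorem a_mem_Bset (D : PairData M n k₀ K T ω) (i : Fin 2) : D.a i ∈ D.Bset :=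
  Or.inl (D.mem_armSet (D.A i).start_mem_support)

/-- **Adjacency to a fence**: `m` is the end point of the fence of some term and `x` is
`𝕋`-adjacent to a site of its connection. [folklore] -/
def AdjF (D : PairData M n k₀ K T ω) (x m : Site 2) : Prop :=
  ∃ (u : ℕ) (c : Finset (Site 2)) (z : Site 2) (hu : (trapDomain M).lowestSeq ω u = some (c, z)),
    m = (D.fence hu).m ∧ ∃ f ∈ (D.fence hu).F, triGraph.Adj x f

/-- **The contracted graph**: `𝕋`-adjacency between non-fence sites, and a non-fence site joined
to the end point of every fence it is adjacent to. [cite: Diestel2017, §1.7] -/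
def cG (D : PairData M n k₀ K T ω) : SimpleGraph (Site 2) where
  Adj x y := x ≠ y ∧ ((x ∉ D.FF ∧ y ∉ D.FF ∧ triGraph.Adj x y) ∨ (x ∉ D.FF ∧ D.AdjF x y) ∨ (y ∉ D.FF ∧ D.AdjF y x))
  symm := ⟨fun _ _ ⟨hne, h⟩ => ⟨hne.symm, by
    rcases h with h | h | h
    · exact Or.inl ⟨h.2.1, h.1, h.2.2.symm⟩
    · exact Or.inr (Or.inr h)
    · exact Or.inr (Or.inl h)⟩⟩
  loopless := ⟨fun _ h => h.1 rfl⟩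

/-- The admissible vertices of the contracted graph: arms, terms, end points. [folklore] -/
def cA (D : PairData M n k₀ K T ω) : Set (Site 2) := D.Bset ∪ D.Tset

/-- A `𝕋`-path through non-fence sites is a path of the contracted graph. [folklore] -/
theorem pathIn_cG_of_pathIn (D : PairData M n k₀ K T ω) {X : Set (Site 2)} {x y : Site 2}
    (h : PathIn triGraph X x y) (hX : ∀ v ∈ X, v ∉ D.FF) : PathIn D.cG X x y := by
  obtain ⟨hx, h⟩ := h
  refine ⟨hx, ?_⟩
  induction h with
  | refl => exact Relation.ReflTransGen.refl
  | @tail b c hb hbc ih =>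
    have hbX : b ∈ X := (show PathIn triGraph X x b from ⟨hx, hb⟩).right_mem
    exact ih.tail ⟨⟨hbc.1.ne, Or.inl ⟨hX b hbX, hX c hbc.2, hbc.1⟩⟩, hbc.2⟩

/-- A path of the contracted graph through non-fence sites is a `𝕋`-path. [folklore] -/
theorem pathIn_of_pathIn_cG (D : PairData M n k₀ K T ω) {X : Set (Site 2)} {x y : Site 2}
    (h : PathIn D.cG X x y) (hX : ∀ v ∈ X, v ∉ D.FF) : PathIn triGraph X x y := by
  obtain ⟨hx, h⟩ := h
  refine ⟨hx, ?_⟩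
  induction h with
  | refl => exact Relation.ReflTransGen.refl
  | @tail b c hb hbc ih =>
    have hbX : b ∈ X := (show PathIn D.cG X x b from ⟨hx, hb⟩).right_mem
    have hadj : triGraph.Adj b c := by
      rcases hbc.1.2 with h | h | h
      · exact h.2.2
      · obtain ⟨u, c', z, hu, hm, -⟩ := h.2
        exact absurd (show c ∈ D.FF by rw [hm]; exact D.Tset_subset_FF (D.m_mem_Tset hu)) (hX c hbc.2)
      · obtain ⟨u, c', z, hu, hm, -⟩ := h.2
        exact absurd (show b ∈ D.FF by rw [hm]; exact D.Tset_subset_FF (D.m_mem_Tset hu)) (hX b hbX)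
    exact ih.tail ⟨hadj, hbc.2⟩

/-! ### No admissible vertex of the contracted graph is a cut -/

/-- **From an admissible `𝕋`-route avoiding `z` to a contracted route avoiding `z`** (`z` a
non-fence site): truncate at the first fence site and enter the end point of that fence. [cite: Diestel2017, §1.7] -/
theorem cRoute_of_route (D : PairData M n k₀ K T ω) {z s t : Site 2} (hz : z ∈ D.Bset) (hs : s ∈ D.Bset) (ht : t ∈ D.Tset)
    (h : PathIn triGraph (D.Aset \ {z}) s t) : ∃ t' ∈ D.Tset, PathIn D.cG (D.cA \ {z}) s t' := by
  have hsR : s ∈ (D.FF)ᶜ := D.not_mem_FF_of_mem_Bset hs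
  have htR : t ∉ (D.FF)ᶜ := fun h' => h' (D.Tset_subset_FF ht)
  obtain ⟨a', b, ha', hbR, -, hab, hP⟩ := h.exit (R := (D.FF)ᶜ) hsR htR
  obtain ⟨u, c, zc, hu, hbFu⟩ : b ∈ D.FF := not_not.1 hbR
  have hsub : (D.FF)ᶜ ∩ (D.Aset \ {z}) ⊆ D.cA \ {z} := fun v hv =>
    ⟨Or.inl (D.mem_Bset_of_mem_Aset hv.2.1 hv.1), hv.2.2⟩
  have hP' : PathIn D.cG (D.cA \ {z}) s a' := (D.pathIn_cG_of_pathIn hP fun v hv => hv.1).mono hsub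
  have ha'F : a' ∉ D.FF := ha'
  have hmF : (D.fence hu).m ∈ D.FF := D.Tset_subset_FF (D.m_mem_Tset hu)
  have hm : (D.fence hu).m ∈ D.cA \ {z} :=
    ⟨Or.inr (D.m_mem_Tset hu), fun hmz => D.not_mem_FF_of_mem_Bset hz (by rw [← Set.mem_singleton_iff.1 hmz]; exact hmF)⟩
  have hadj : D.cG.Adj a' (D.fence hu).m :=
    ⟨fun h' => ha'F (by rw [h']; exact hmF), Or.inr (Or.inl ⟨ha'F, u, c, zc, hu, rfl, b, hbFu, hab⟩)⟩
  exact ⟨_, D.m_mem_Tset hu, hP'.tail hadj hm⟩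

/-- **The canonical fence-free route** of the arm `i` to the attachment site of the fence of its
minimal term: along an arm (and inside the term). [cite: Nolin2008, §4.4 Lemma 15 (proof) (arXiv 0711.4948: Lemma 14)] -/
theorem canonical_route (D : PairData M n k₀ K T ω) (i : Fin 2) {c : Finset (Site 2)} {z : Site 2}
    (hu : (trapDomain M).lowestSeq ω (D.uMin i) = some (c, z)) :
    ∃ i', PathIn triGraph D.Bset (D.a i') (D.fence hu).q := by
  classical
  rcases (D.fence hu).q_mem with hq | ⟨i', hq⟩
  · obtain ⟨x, hx⟩ := D.αF_meet i hu
    rw [Finset.mem_inter] at hx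
    have hxA : x ∈ (D.A i).support := D.αF_subset i x hx.1
    have h1 : PathIn triGraph D.Bset (D.a i) x :=
      PathIn.of_walk ((D.A i).takeUntil x hxA) fun v hv =>
        Or.inl (D.mem_armSet ((D.A i).support_takeUntil_subset_support hxA hv))
    have h2 : PathIn triGraph D.Bset x (D.fence hu).q :=
      ((term_isCrossing hu).conn x hx.2 (D.fence hu).q (Finset.mem_coe.1 hq)).mono fun v hv => Or.inr ⟨_, c, z, hu, hv⟩
    exact ⟨i, h1.trans h2⟩
  · exact ⟨i', PathIn.of_walk ((D.A i').takeUntil (D.fence hu).q hq) fun v hv =>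
      Or.inl (D.mem_armSet ((D.A i').support_takeUntil_subset_support hq hv))⟩

/-- **No admissible vertex of the contracted graph is a cut** (Menger's second hypothesis in
`cG`). [cite: Nolin2008, §4.4 Lemma 15 (proof) (arXiv 0711.4948: Lemma 14, last paragraph)] [cite: Diestel2017, §1.7] -/
theorem hcut_cG (D : PairData M n k₀ K T ω) :
    ∀ zz ∈ D.cA, ∃ (s t : Site 2) (q : D.cG.Walk s t), s ∈ ({D.a 0, D.a 1} : Set (Site 2)) ∧ t ∈ D.Tset ∧
      (∀ y ∈ q.support, y ∈ D.cA) ∧ zz ∉ q.support := by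
  classical
  rintro zz (hzz | hzz)
  · -- a non-fence site: Menger's hypothesis of the `𝕋`-setting, truncated at the first fence site
    obtain ⟨s, t, q, hs, ht, hqA, hzq⟩ := D.menger_hcut zz (D.Bset_subset_Aset hzz)
    have hP : PathIn triGraph (D.Aset \ {zz}) s t :=
      PathIn.of_walk q fun x hx => ⟨hqA x hx, fun h => hzq (by rw [← Set.mem_singleton_iff.1 h]; exact hx)⟩
    have hsB : s ∈ D.Bset := by
      rcases hs with h | h
      · rw [h]; exact D.a_mem_Bset 0
      · rw [Set.mem_singleton_iff.1 h]; exact D.a_mem_Bset 1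
    obtain ⟨t', ht', hP'⟩ := D.cRoute_of_route hzz hsB ht hP
    obtain ⟨w, hw⟩ := hP'.exists_walk
    exact ⟨s, t', w, hs, ht', fun y hy => (hw y hy).1, fun hy => (hw zz hy).2 (Set.mem_singleton zz)⟩
  · -- an end point `m_w`: the canonical route of the arm whose minimal term is not `w`
    obtain ⟨w, cw, zw, hw, rfl⟩ := hzz
    obtain ⟨i, hi⟩ : ∃ i : Fin 2, D.uMin i ≠ w := by
      by_cases h : D.uMin 0 = w
      · exact ⟨1, fun h' => D.uMin_ne (show (0 : Fin 2) ≠ 1 by decide) (h.trans h'.symm)⟩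
      · exact ⟨0, h⟩
    obtain ⟨c, z, hu, -⟩ := D.uMin_spec i
    obtain ⟨i', hroute⟩ := D.canonical_route i hu
    have hqB : (D.fence hu).q ∈ D.Bset := hroute.right_mem
    have hqF : (D.fence hu).q ∉ D.FF := D.not_mem_FF_of_mem_Bset hqB
    have hmuF : (D.fence hu).m ∈ D.FF := ⟨_, c, z, hu, (D.fence hu).m_mem⟩
    have hmwF : (D.fence hw).m ∈ D.FF := ⟨w, cw, zw, hw, (D.fence hw).m_mem⟩
    have hP : PathIn D.cG (D.cA \ {(D.fence hw).m}) (D.a i') (D.fence hu).q :=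
      (D.pathIn_cG_of_pathIn hroute fun v hv => D.not_mem_FF_of_mem_Bset hv).mono fun v hv =>
        ⟨Or.inl hv, fun h => D.not_mem_FF_of_mem_Bset hv (by rw [Set.mem_singleton_iff.1 h]; exact hmwF)⟩
    have hmu : (D.fence hu).m ∈ D.cA \ {(D.fence hw).m} := by
      refine ⟨Or.inr (D.m_mem_Tset hu), fun h => ?_⟩
      exact D.fence_disjoint_fence hi hu hw (D.fence hu).m_mem (by rw [Set.mem_singleton_iff.1 h]; exact (D.fence hw).m_mem)
    have hadj : D.cG.Adj (D.fence hu).q (D.fence hu).m :=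
      ⟨fun h => hqF (by rw [h]; exact hmuF),
        Or.inr (Or.inl ⟨hqF, _, c, z, hu, rfl, (D.fence hu).p, (D.fence hu).p_mem, (D.fence hu).adj⟩)⟩
    obtain ⟨q, hq⟩ := (hP.tail hadj hmu).exists_walk
    refine ⟨D.a i', (D.fence hu).m, q, ?_, D.m_mem_Tset hu, fun y hy => (hq y hy).1, fun hy => (hq _ hy).2 (Set.mem_singleton _)⟩
    fin_cases i' <;> simp

/-! ### Two clean routes -/

/-- **Two vertex-disjoint routes, each touching only its own fence** (see the module docstring):
terms `u₀ ≠ u₁`, sets `S₀, S₁` with `PathIn 𝕋 Sᵢ (a i) m_{uᵢ}`, `Sᵢ ⊆ (arms ∪ terms) ∪ F_{uᵢ}`,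
`S₀ ∩ S₁ = ∅`. [cite: Nolin2008, §4.4 Lemma 15 (proof) (arXiv 0711.4948: Lemma 14, last paragraph)] [cite: Diestel2017, Thm. 3.3.1 and §1.7] -/
theorem exists_two_clean_routes (D : PairData M n k₀ K T ω) :
    ∃ (u₀ u₁ : ℕ) (c₀ c₁ : Finset (Site 2)) (z₀ z₁ : Site 2)
      (hu₀ : (trapDomain M).lowestSeq ω u₀ = some (c₀, z₀)) (hu₁ : (trapDomain M).lowestSeq ω u₁ = some (c₁, z₁)),
      u₀ ≠ u₁ ∧ ∃ S₀ S₁ : Set (Site 2),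
        PathIn triGraph S₀ (D.a 0) (D.fence hu₀).m ∧ PathIn triGraph S₁ (D.a 1) (D.fence hu₁).m ∧
        S₀ ⊆ D.Bset ∪ (D.fence hu₀).F ∧ S₁ ⊆ D.Bset ∪ (D.fence hu₁).F ∧ Disjoint S₀ S₁ := by
  classical
  have hone : ∃ (s t : Site 2) (q : D.cG.Walk s t), s ∈ ({D.a 0, D.a 1} : Set (Site 2)) ∧ t ∈ D.Tset ∧
      ∀ y ∈ q.support, y ∈ D.cA := by
    obtain ⟨s, t, q, hs, ht, hA, -⟩ := D.hcut_cG (D.a 0) (Or.inl (D.a_mem_Bset 0))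
    exact ⟨s, t, q, hs, ht, hA⟩
  obtain ⟨s₁, t₁, s₂, t₂, p₁, p₂, hs₁, ht₁, hs₂, ht₂, -, -, hA₁, hA₂, hdisj⟩ :=
    exists_two_disjoint_paths (G := D.cG) hone D.hcut_cG
  -- finishing a contracted route: truncate at the first end point, enter the fence connection
  have finish : ∀ {s t : Site 2} (p : D.cG.Walk s t), s ∈ D.Bset → t ∈ D.Tset → (∀ y ∈ p.support, y ∈ D.cA) →
      ∃ (u : ℕ) (c : Finset (Site 2)) (z : Site 2) (hu : (trapDomain M).lowestSeq ω u = some (c, z)) (S : Set (Site 2)),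
        (D.fence hu).m ∈ p.support ∧ PathIn triGraph S s (D.fence hu).m ∧ S ⊆ D.Bset ∪ (D.fence hu).F ∧
        S ⊆ {v | v ∈ p.support ∧ v ∈ D.Bset} ∪ (D.fence hu).F := by
    intro s t p hs ht hpA
    have hP : PathIn D.cG {v | v ∈ p.support} s t := PathIn.of_walk p fun x hx => hx
    have hsR : s ∈ (D.Tset)ᶜ := fun h => D.not_mem_FF_of_mem_Bset hs (D.Tset_subset_FF h)
    have htR : t ∉ (D.Tset)ᶜ := fun h => h ht
    obtain ⟨a', b, -, hbR, hbp, hab, hQ⟩ := hP.exit (R := (D.Tset)ᶜ) hsR htR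
    obtain ⟨u, c, z, hu, rfl⟩ : b ∈ D.Tset := not_not.1 hbR
    have hpre : (D.Tset)ᶜ ∩ {v | v ∈ p.support} ⊆ {v | v ∈ p.support ∧ v ∈ D.Bset} := fun v hv =>
      ⟨hv.2, by rcases hpA v hv.2 with h | h; exacts [h, absurd h hv.1]⟩
    have hQ' : PathIn triGraph {v | v ∈ p.support ∧ v ∈ D.Bset} s a' :=
      D.pathIn_of_pathIn_cG (hQ.mono hpre) fun v hv => D.not_mem_FF_of_mem_Bset hv.2
    have ha'F : a' ∉ D.FF := D.not_mem_FF_of_mem_Bset (hpre hQ.right_mem).2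
    have hmF : (D.fence hu).m ∈ D.FF := D.Tset_subset_FF (D.m_mem_Tset hu)
    -- the edge `a' → m_u` of `cG` is an adjacency of `a'` to a site `f` of `F_u`
    obtain ⟨f, hfF, haf⟩ : ∃ f ∈ (D.fence hu).F, triGraph.Adj a' f := by
      rcases hab.2 with h | h | h
      · exact absurd hmF h.2.1
      · obtain ⟨u', c', z', hu', hm, f, hf, hadj⟩ := h.2
        have huu : u = u' := by
          by_contra hne
          exact D.fence_disjoint_fence hne hu hu' (D.fence hu).m_mem (by rw [hm]; exact (D.fence hu').m_mem)
        subst huu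
        obtain ⟨rfl, rfl⟩ := term_eq hu hu'
        exact ⟨f, hf, hadj⟩
      · exact absurd hmF h.1
    refine ⟨u, c, z, hu, {v | v ∈ p.support ∧ v ∈ D.Bset} ∪ (D.fence hu).F, hbp, ?_, ?_, subset_rfl⟩
    · exact ((hQ'.mono Set.subset_union_left).tail haf (Or.inr hfF)).trans
        (((D.fence hu).pathIn_to_m hfF).mono Set.subset_union_right)
    · exact Set.union_subset_union_left _ fun v hv => hv.2
  have hsB : ∀ {s : Site 2}, s ∈ ({D.a 0, D.a 1} : Set (Site 2)) → s ∈ D.Bset := by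
    intro s hs
    rcases hs with h | h
    · rw [h]; exact D.a_mem_Bset 0
    · rw [Set.mem_singleton_iff.1 h]; exact D.a_mem_Bset 1
  obtain ⟨v₁, d₁, w₁, hv₁, S₁, hm₁, hP₁, hS₁, hS₁'⟩ := finish p₁ (hsB hs₁) ht₁ hA₁
  obtain ⟨v₂, d₂, w₂, hv₂, S₂, hm₂, hP₂, hS₂, hS₂'⟩ := finish p₂ (hsB hs₂) ht₂ hA₂
  have hv : v₁ ≠ v₂ := by
    rintro rfl
    obtain ⟨rfl, rfl⟩ := term_eq hv₁ hv₂
    exact hdisj _ hm₁ hm₂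
  have hdisjS : Disjoint S₁ S₂ := by
    rw [Set.disjoint_left]
    intro y hy₁ hy₂
    rcases hS₁' hy₁ with h₁ | h₁ <;> rcases hS₂' hy₂ with h₂ | h₂
    · exact hdisj y h₁.1 h₂.1
    · exact D.not_mem_FF_of_mem_Bset h₁.2 ⟨_, _, _, hv₂, h₂⟩
    · exact D.not_mem_FF_of_mem_Bset h₂.2 ⟨_, _, _, hv₁, h₁⟩
    · exact D.fence_disjoint_fence hv hv₁ hv₂ h₁ h₂
  have hs : s₁ ≠ s₂ := fun h => hdisj s₁ p₁.start_mem_support (by rw [h]; exact p₂.start_mem_support)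
  simp only [Set.mem_insert_iff, Set.mem_singleton_iff] at hs₁ hs₂
  rcases hs₁ with rfl | rfl <;> rcases hs₂ with rfl | rfl
  · exact absurd rfl hs
  · exact ⟨v₁, v₂, d₁, d₂, w₁, w₂, hv₁, hv₂, hv, S₁, S₂, hP₁, hP₂, hS₁, hS₂, hdisjS⟩
  · exact ⟨v₂, v₁, d₂, d₁, w₂, w₁, hv₂, hv₁, hv.symm, S₂, S₁, hP₂, hP₁, hS₂, hS₁, hdisjS.symm⟩
  · exact absurd rfl hs

/-- **Sites of a clean route are admissible** (hence open, in the annulus or in the zone of its own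
fence). [folklore] -/
theorem clean_route_subset_Aset (D : PairData M n k₀ K T ω) {u : ℕ} {c : Finset (Site 2)} {z : Site 2}
    (hu : (trapDomain M).lowestSeq ω u = some (c, z)) {S : Set (Site 2)} (hS : S ⊆ D.Bset ∪ (D.fence hu).F) :
    S ⊆ D.Aset := fun v hv => by
  rcases hS hv with h | h
  · exact D.Bset_subset_Aset h
  · exact D.fence_subset_Aset hu h

/-- **A clean route avoids every other fence.** [folklore] -/
theorem clean_route_disjoint_fence (D : PairData M n k₀ K T ω) {u w : ℕ} (huw : u ≠ w) {c c' : Finset (Site 2)} {z z' : Site 2}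
    (hu : (trapDomain M).lowestSeq ω u = some (c, z)) (hw : (trapDomain M).lowestSeq ω w = some (c', z'))
    {S : Set (Site 2)} (hS : S ⊆ D.Bset ∪ (D.fence hu).F) : Disjoint S (D.fence hw).F := by
  rw [Set.disjoint_left]
  intro v hv hvw
  rcases hS hv with h | h
  · exact D.not_mem_FF_of_mem_Bset h ⟨w, c', z', hw, hvw⟩
  · exact D.fence_disjoint_fence huw hu hw h hvw

/-- **Non-fence sites of a clean route lie in `Λ_{2M}`** (arms and terms have norm `≤ 2M`), so the
sites of a clean route outside `Λ_{2M}` belong to its own fence connection. [folklore] -/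
theorem clean_route_exterior (D : PairData M n k₀ K T ω) {u : ℕ} {c : Finset (Site 2)} {z : Site 2}
    (hu : (trapDomain M).lowestSeq ω u = some (c, z)) {S : Set (Site 2)} (hS : S ⊆ D.Bset ∪ (D.fence hu).F)
    {v : Site 2} (hv : v ∈ S) (hvn : 2 * (M : ℤ) < triNorm v) : v ∈ (D.fence hu).F := by
  rcases hS hv with (h | ⟨u', c', z', hu', h⟩) | h
  · exact absurd (D.armSet_norm_le h) (not_le.2 hvn)
  · exact absurd (term_norm_le hu' (Finset.mem_coe.1 h)) (not_le.2 hvn)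
  · exact h

end PairData

end Literature.Probability.Percolation
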